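import Literature.MathematicalPhysics.QuantumLattice.WilsonHoppingBound
import Literature.MathematicalPhysics.QuantumLattice.LinkHopCommutators
import HarnessLib

/-!
# Neuberger's lower bound for the Wilson–Dirac operator (local quadratic-form version)

Topic `Literature/MathematicalPhysics/QuantumLattice`; namespace
`Literature.MathematicalPhysics.QuantumLattice`.

**Theorem** [Neuberger2000Bounds, §"Lower bound"], transcribed to the tree
(`wilsonDirac ρ U m 1 = D_W(m) = m + Σ_μ(1 − V_μ)`, `V_μ = W_μ = F_μ ⊗ P⁻_μ + F_μᴴ ⊗ P⁺_μ`,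
`F_μ = linkHop ρ U μ = T_μ`, see `OverlapLocality.wilsonDirac_eq_sub_sum_wilsonHop`): for a unitary
representation `ρ`, ANY gauge field `U` on `(ℤ/L)⁴` (`L ≥ 1`), `m ≥ −1`, `δ ≥ 0`:

* `wilsonDirac_normSq_mulVec_ge_of_plaquette_near_support` (LOCAL): if every plaquette `U_p`
  based at a site within torus (`ℓ^∞`) distance `1` of the site support of `v` has
  `‖1 − ρ(U_p)‖ ≤ δ`, then `Σ_i ‖(D_W v)_i‖² ≥ (m² − 30δ) Σ_i ‖v_i‖²`;
* `wilsonDirac_normSq_mulVec_ge_of_plaquette` (GLOBAL): the same under `‖1 − ρ(U_p)‖ ≤ δ` for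
  all plaquettes (at `m = −1` the twin of HJL's `A†A ≥ 1 − 30ε`, [HernandezJansenLuscher1999]
  (2.16));
* `norm_one_sub_le_sqrt_two_mul_trace_deficit`: for a unitary `u`, `‖1 − u‖ ≤ √(2(N − Re tr u))`
  (operator norm ≤ Frobenius norm), converting Wilson-action plaquette deficits into the norm
  hypothesis above.

Proof: `WilsonHoppingAlgebra` / `WilsonHoppingBound` (abstract bound for four unitaries with
`δ`-small mixed commutators on a support class) and `LinkHopCommutators` (the mixed commutators
of the twisted shifts are plaquette holonomies based within distance `1` of the support), glued
through the associator `(site × colour) × spin ≃ site × colour × spin` behind `wilsonHop`'s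
`reindex`.  Constant: `30 δ` (`5δ/2` per ordered pair `μ ≠ ν`); radius `1`.  Not here: the flow
inequality `|dλ/dm| ≤ 1` and the extension of the bound to `m < −1`, the upper bound, the free
(`[T_μ,T_ν] = 0`) spectrum.

Reference: H. Neuberger, *Bounds on the Wilson Dirac operator*, Phys. Rev. D 61 (2000) 085015,
arXiv:hep-lat/9911004, §"Lower bound". [Neuberger2000Bounds]
-/

noncomputable section

open Matrix Finset
open scoped Kronecker ComplexOrder Matrix.Norms.L2Operator
open Literature.Probability.LatticeModels (TorusSite)
open Literature.MathematicalPhysics.QuantumFieldTheory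
open Literature.MathematicalPhysics.QuantumLattice.NeubergerBound

namespace Literature.MathematicalPhysics.QuantumLattice

section WilsonDiracFloor

variable {L N : ℕ} [NeZero L] {G : Type*} [Group G] (ρ : G →* Matrix (Fin N) (Fin N) ℂ)

/-- **The Wilson operator through the associator**: entrywise,
`(D_W v)(i) = (D' (v ∘ e))(e⁻¹ i)` with `e` the associator
`(site × colour) × spin ≃ site × colour × spin`
and `D' = (m + 4)·1 − Σ_μ (F_μ ⊗ P⁻_μ + F_μᴴ ⊗ P⁺_μ)` the honest Kronecker form. [folklore] -/
theorem wilsonDirac_mulVec_apply_eq (hρ : ∀ g, ρ g ∈ Matrix.unitaryGroup (Fin N) ℂ)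
    (U : GaugeConfig 4 L G) (m : ℝ) (v : TorusSite 4 L × Fin N × Fin 4 → ℂ)
    (i : TorusSite 4 L × Fin N × Fin 4) :
    (wilsonDirac ρ U m 1 *ᵥ v) i =
      ((((m + 4 : ℝ) : ℂ) •
            (1 : Matrix ((TorusSite 4 L × Fin N) × Fin 4) ((TorusSite 4 L × Fin N) × Fin 4) ℂ) -
          ∑ μ, (linkHop ρ U μ ⊗ₖ chiralProjMinus μ + (linkHop ρ U μ)ᴴ ⊗ₖ chiralProjPlus μ)) *ᵥ
        (v ∘ ⇑(Equiv.prodAssoc (TorusSite 4 L) (Fin N) (Fin 4))))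
        ((Equiv.prodAssoc (TorusSite 4 L) (Fin N) (Fin 4)).symm i) := by
  rw [wilsonDirac_eq_sub_sum_wilsonHop ρ hρ U m]
  simp only [sub_mulVec, smul_mulVec, one_mulVec, sum_mulVec, Pi.sub_apply, Pi.smul_apply,
    Finset.sum_apply, wilsonHop, reindex_apply, submatrix_mulVec_equiv, Equiv.symm_symm,
    Function.comp_apply, Equiv.apply_symm_apply]

/-- **Neuberger's lower bound for the Wilson–Dirac operator, local form.**  Let `ρ` be a
unitary representation, `U` any gauge field on the periodic lattice `(ℤ/L)⁴`, `m ≥ −1`, `δ ≥ 0`, and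
`v` a fermion field such that every plaquette based within torus distance `1` of the site support
of `v` satisfies `‖1 − ρ(U_p)‖ ≤ δ` (operator norm on colour space).  Then
`‖D_W(U, m) v‖² ≥ (m² − 30 δ) ‖v‖²`.  From Neuberger's identity
`D_WᴴD_W = m² + 2(m+1)Σ_μ(1 − h_μ) + Σ_{μ≠ν}[(1−h_μ)(1−h_ν) − a_μa_ν − [a_μ,h_ν]]` with the
middle term `≥ 0` for `m ≥ −1` and the curvature terms bounded through `‖[T_μ, T_ν]‖ = ‖1 − U_{μν}‖`
(constant `30 = 6·5` per unordered pair instead of the printed `6(2+√2)`).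
[cite: Neuberger2000Bounds, §Lower bound] -/
theorem wilsonDirac_normSq_mulVec_ge_of_plaquette_near_support
    (hρ : ∀ g, ρ g ∈ Matrix.unitaryGroup (Fin N) ℂ) (U : GaugeConfig 4 L G) (m : ℝ) (hm : -1 ≤ m)
    (δ : ℝ) (hδ : 0 ≤ δ) (v : TorusSite 4 L × Fin N × Fin 4 → ℂ)
    (hv : ∀ y : TorusSite 4 L, (∃ x : TorusSite 4 L, (∃ a α, v (x, a, α) ≠ 0) ∧ torusDist x y ≤ 1) →
      ∀ μ ν : Fin 4, μ ≠ ν →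
        ‖(1 : Matrix (Fin N) (Fin N) ℂ) - ρ (plaquetteHolonomy U y μ ν)‖ ≤ δ) :
    (m ^ 2 - 30 * δ) * ∑ i, ‖v i‖ ^ 2 ≤ ∑ i, ‖(wilsonDirac ρ U m 1 *ᵥ v) i‖ ^ 2 := by
  set e := Equiv.prodAssoc (TorusSite 4 L) (Fin N) (Fin 4) with he
  set v' : (TorusSite 4 L × Fin N) × Fin 4 → ℂ := v ∘ ⇑e with hv'
  have h1 : ∑ i, ‖v i‖ ^ 2 = eucNorm v' ^ 2 := by
    rw [eucNorm_sq_eq_sum]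
    exact (Fintype.sum_equiv e _ _ fun p => rfl).symm
  have h2 : ∑ i, ‖(wilsonDirac ρ U m 1 *ᵥ v) i‖ ^ 2 =
      eucNorm ((((m + 4 : ℝ) : ℂ) • (1 : Matrix ((TorusSite 4 L × Fin N) × Fin 4) _ ℂ) -
        ∑ μ, (linkHop ρ U μ ⊗ₖ chiralProjMinus μ + (linkHop ρ U μ)ᴴ ⊗ₖ chiralProjPlus μ)) *ᵥ
          v') ^ 2 := by
    rw [eucNorm_sq_eq_sum]
    exact Fintype.sum_equiv e.symm _ _ fun i => by rw [wilsonDirac_mulVec_apply_eq ρ hρ]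
  rw [h1, h2]
  exact sq_sub_thirty_mul_le_eucNorm_sq_hoppingOp_mulVec (linkHop ρ U)
    (conjTranspose_mul_linkHop ρ hρ U) (linkHop_mul_conjTranspose ρ hρ U)
    (S := fun p : TorusSite 4 L × Fin N => ∃ a α, v (p.1, a, α) ≠ 0)
    (linkHop_comm_bounds_of_plaquette ρ hρ U hδ hv) hδ m hm v' fun p α h => ⟨p.2, α, h⟩

/-- **Neuberger's lower bound, global form**: if `‖1 − ρ(U_p)‖ ≤ δ` for every plaquette then
`‖D_W(U, m) v‖² ≥ (m² − 30 δ)‖v‖²` for all `m ≥ −1` and all `v` (for `m = −1`, `d = 4` this is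
the twin of HJL's `A†A ≥ 1 − 30ε`). [cite: Neuberger2000Bounds, §Lower bound] -/
theorem wilsonDirac_normSq_mulVec_ge_of_plaquette
    (hρ : ∀ g, ρ g ∈ Matrix.unitaryGroup (Fin N) ℂ) (U : GaugeConfig 4 L G) (m : ℝ) (hm : -1 ≤ m)
    (δ : ℝ) (hδ : 0 ≤ δ)
    (hU : ∀ (y : TorusSite 4 L) (μ ν : Fin 4), μ ≠ ν →
      ‖(1 : Matrix (Fin N) (Fin N) ℂ) - ρ (plaquetteHolonomy U y μ ν)‖ ≤ δ)
    (v : TorusSite 4 L × Fin N × Fin 4 → ℂ) :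
    (m ^ 2 - 30 * δ) * ∑ i, ‖v i‖ ^ 2 ≤ ∑ i, ‖(wilsonDirac ρ U m 1 *ᵥ v) i‖ ^ 2 :=
  wilsonDirac_normSq_mulVec_ge_of_plaquette_near_support ρ hρ U m hm δ hδ v fun y _ => hU y

end WilsonDiracFloor

section TraceDeficit

/-- **Operator norm versus trace deficit** for a unitary matrix:
`‖1 − u‖ ≤ √(2(N − Re tr u))` (`‖1 − u‖² ≤ ‖1 − u‖_F² = tr (1−u)ᴴ(1−u) = 2N − 2 Re tr u`).
For `SU(3)` this converts a plaquette trace deficit `3 − Re tr U_p ≤ ε` into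
`‖1 − U_p‖ ≤ √(2ε)`. [folklore] -/
theorem norm_one_sub_le_sqrt_two_mul_trace_deficit {N : ℕ} (u : Matrix (Fin N) (Fin N) ℂ)
    (hu : u ∈ Matrix.unitaryGroup (Fin N) ℂ) :
    ‖(1 : Matrix (Fin N) (Fin N) ℂ) - u‖ ≤ Real.sqrt (2 * ((N : ℝ) - u.trace.re)) := by
  set A : Matrix (Fin N) (Fin N) ℂ := 1 - u with hA
  have huu : uᴴ * u = 1 := Matrix.mem_unitaryGroup_iff'.mp hu
  have hAA : Aᴴ * A = (1 + 1) - (u + uᴴ) := by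
    rw [hA, conjTranspose_sub, conjTranspose_one, sub_mul, mul_sub, mul_sub, one_mul, one_mul,
      mul_one, huu]
    abel
  have hfrob : ∑ i, ∑ j, ‖A i j‖ ^ 2 = 2 * ((N : ℝ) - u.trace.re) := by
    have htr : (Aᴴ * A).trace = ((∑ i, ∑ j, ‖A i j‖ ^ 2 : ℝ) : ℂ) := by
      rw [trace, Finset.sum_comm]
      push_cast
      refine Finset.sum_congr rfl fun i _ => ?_
      rw [diag_apply, mul_apply]
      refine Finset.sum_congr rfl fun j _ => ?_
      rw [conjTranspose_apply, Complex.star_def, Complex.conj_mul']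
    have h2 := congrArg (fun z : ℂ => z.re) htr
    simp only [Complex.ofReal_re] at h2
    rw [← h2, hAA, trace_sub, trace_add, trace_add, trace_one, trace_conjTranspose,
      Complex.sub_re, Complex.add_re, Complex.add_re, Fintype.card_fin, Complex.star_def,
      Complex.conj_re]
    simp only [Complex.natCast_re]
    ring
  have hvec : ∀ x : Fin N → ℂ,
      eucNorm (A *ᵥ x) ≤ Real.sqrt (2 * ((N : ℝ) - u.trace.re)) * eucNorm x := by
    intro x
    have hsq : eucNorm (A *ᵥ x) ^ 2 ≤ (∑ i, ∑ j, ‖A i j‖ ^ 2) * eucNorm x ^ 2 := by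
      rw [eucNorm_sq_eq_sum, Finset.sum_mul]
      refine Finset.sum_le_sum fun i _ => ?_
      have hcs := norm_star_dotProduct_le (star (A i)) x
      rw [star_star] at hcs
      calc ‖(A *ᵥ x) i‖ ^ 2 = ‖A i ⬝ᵥ x‖ ^ 2 := rfl
        _ ≤ (eucNorm (star (A i)) * eucNorm x) ^ 2 := pow_le_pow_left₀ (norm_nonneg _) hcs 2
        _ = (∑ j, ‖A i j‖ ^ 2) * eucNorm x ^ 2 := by
          rw [mul_pow, eucNorm_sq_eq_sum]
          simp only [Pi.star_apply, norm_star]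
    rw [hfrob] at hsq
    have h := Real.sqrt_le_sqrt hsq
    rwa [Real.sqrt_sq (eucNorm_nonneg _), Real.sqrt_mul' _ (sq_nonneg _),
      Real.sqrt_sq (eucNorm_nonneg _)] at h
  rw [← Matrix.l2_opNorm_toEuclideanCLM]
  refine ContinuousLinearMap.opNorm_le_bound _ (Real.sqrt_nonneg _) fun x => ?_
  exact hvec (WithLp.ofLp x)

end TraceDeficit

end Literature.MathematicalPhysics.QuantumLattice
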